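import Summits.HodgeConjecture.HodgeConjecture.Theorems.K2E3BranchBShellZeroFibres               -- ★ (K2E3-p04) inert fibres; brings ★ `K2E3BranchBSkewLineIntegrals` (`valued_heisZ_apply_eq_max`, `conj_half_mul_conj_and_valued`), ★ `K2E3BranchBSkewUnitSign`, the `HeisRing` chart
import Summits.HodgeConjecture.HodgeConjecture.Theorems.R90S1RamifiedFixedSkewShellGeometry       -- ★∕📤 (this seat) `e = 2` shell geometry: `valued_skew_ne_one_ram` (no anti-fixed unit at a tame ramified place)
import HarnessLib

/-!
# R90 · S1 ∕ U4Keys leaf (U4f-χ₁-ram-one-d0B) — THE SHELL-ZERO `y`-FIBRES OF `E ∘ z` AT A TAME RAMIFIED PLACE: over `{y : |heisZ σ x y|_w = 1}` the fibre is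
# `χ₁(−½) · μ⁻{|y|_w < 1}` if `|x|_w = 1` and `0` if `|x|_w < 1` (the `e = 2` twin of ★ `K2E3BranchBShellZeroFibres` §2)
# [Keys1984 §7 Thm (2) (d); Rogawski1990 §1.10, §12.2 (2); SerreLocalFields1979 Ch. IV §2 Prop. 5; PAPER-Z3-DepthZeroRamified §1 (R90-C10-p05 (g0), r01-screened)]

Cell `hodgecm-mathlib`, SLAB R90-TF, section S1 «Ch. 12 local», crux H413 = `stmt-HodgeConjecture-24833` (lane `--supports … --as helper`), route HCCMUnconditional; prover seat
`hodgecm-mathlib-R90-C10-p05` (g0); socket of record S1#3′ = K2E3 leaf (U4f-χ₁-ram-one) ⊇ U4Keys :155 (depth 0, Branch B).  THEOREMS ONLY (no definition ∕ instance ∕ notation ∕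
named fact ∕ `sorry`); ★-only imports.  FRAME (v1 spellings, as ★ `K2E3BranchBShellZeroFibres`): `R := LocalRing L v`, `σ := conjLocal L c v`, `R⁻ = skewPart σ`; `v` non-split (`hw`),
`w ∣ v` RAMIFIED (`he`), `|2|_w = 1` (`h2w`, `[Invertible (2 : R)]`); the :155 letters `hdepth`, `hB`; `μ⁻ = μY` any measure on `R⁻`; `E r := χ₁(r̂)` if `r ∈ Rˣ` else `0`.

THE POINT.  At an INERT place the shell-zero fibre over `|x|_w = 1` is the skew-line integral `Φ₁⁺ = ∫_{|y|_w ≤ 1} E(1 + y)` (★ `heisZFibre_eq_of_valued_eq_one`, a character sum in disguise)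
and over `|x|_w < 1` it is `χ₁(δ₀)·μ⁻{|y|_w = 1}` (skew units exist).  At a TAME RAMIFIED place there is NO anti-fixed unit (★ `valued_skew_ne_one_ram`: anti-fixed elements have odd order),
so with `a = −½xσx` (`σ`-fixed, `|a|_w = |x|_w²`, ★ `conj_half_mul_conj_and_valued`) and `|a + y|_w = max(|a|_w, |y|_w)` (★ `valued_heisZ_apply_eq_max`): the fibre set `{|a + y|_w = 1}` is
`{|y|_w < 1}` when `|x|_w = 1` and EMPTY when `|x|_w < 1`; on it `a + y = a·(1 + y∕a)` with `1 + y∕a` principal, so `E(a + y) = χ₁(â) = χ₁(−½)·χ₁(x̂·σx̂) = χ₁(−½)` (`hdepth`, `hB`).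
* §1 `valued_skew_apply_ne_one_ram` (`y ∈ R⁻ ⟹ |y_w|_w ≠ 1`), `valued_heisZ_apply_eq_one_iff_ram` (`|heisZ σ x y|_w = 1 ⟺ |x|_w = 1 ∧ |y|_w < 1`).
* §2 **`heisZFibre_eq_of_valued_eq_one_ram`** (`|x|_w = 1`: fibre `= χ₁(−½)·μ⁻.real{|y|_w < 1}`), **`heisZFibre_eq_zero_of_valued_lt_one_ram`** (`|x|_w < 1`: fibre `= 0`); `|x|_w > 1` is ★
  `heisZFibre_eq_zero_of_one_lt_valued` (place-generic).  With `μR{|x|_w = 1} = (1 − q⁻¹)·μR(𝒪)` the assembler's `x`-integral is `χ₁(−½)·(1 − q⁻¹)·μR(𝒪)·μ⁻{|y|_w < 1} = χ₁(−2)·((q−1)∕q)·V`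
  — the constant `h0` of ★ `R90S1KeysThmTwoDepthZeroBranchBRamified` (`χ₁(−½) = χ₁(−2)` as `χ₁² = 1` on fixed units).
HONEST LABEL.  HC_CM is proved only modulo the 7 printed citations (2 remaining named inputs: hLiu418 = `stmt-HodgeConjecture-24832`, h413 = `stmt-HodgeConjecture-24833`) until rung 0
closes; count-neutral — this file does NOT pay the leaf; no printed citation is discharged.

## References
* [Keys1984] D. Keys, *Principal series representations of special unitary groups over local fields*, Compositio Math. 51 (1984), §4–§5, §7 Theorem (2) (d) p. 126.
* [Rogawski1990] J. D. Rogawski, *Automorphic Representations of Unitary Groups in Three Variables*, Ann. of Math. Stud. 123 (1990), §1.10 p. 9, §12.2 (2) p. 173.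
* [SerreLocalFields1979] J.-P. Serre, *Local Fields*, GTM 67 (1979), Ch. III §6, Ch. IV §2 Prop. 5.
-/

set_option autoImplicit false
-- the mandated namespace has the single-problem summit's repeated segment (`HodgeConjecture.HodgeConjecture`)
set_option linter.dupNamespace false

noncomputable section

open NumberField IsDedekindDomain MeasureTheory Measure Topology Set
open scoped NNReal ENNReal
open Literature.NumberTheory Literature.NumberTheory.Automorphic Literature.NumberTheory.Automorphic.UnitaryGroup

namespace Summit.HodgeConjecture.HodgeConjecture.R90.S1

open Summit.HodgeConjecture.HodgeConjecture.Cruxes.H413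
open Summit.HodgeConjecture.HodgeConjecture.Cruxes.H413.K2E3BranchBSkewUnitSign
open Summit.HodgeConjecture.HodgeConjecture.Cruxes.H413.K2E3BranchBSkewLineIntegrals
open Summit.HodgeConjecture.HodgeConjecture.Cruxes.H413.K2E3BranchBShellZeroFibres

variable (L : Type) [Field L] [NumberField L] [IsCMField L] (v : HeightOneSpectrum (𝓞 ↥(maximalRealSubfield L)))
  (w : PlacesOver L v) (hw : IsCMField.complexConj L • w.1 = w.1)

/-! ## §1 Shell-zero membership in the chart `z = heisZ σ x y` at a tame ramified place -/

include hw in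
/-- **No skew unit at a tame ramified place (frame currency)**: `σ y = −y` in `R = Π_{w′∣v} L_{w′}` ⟹ `|y_w|_w ≠ 1` — `(σ y)_w = σ_w(y_w)` (★ `conjLocal_apply_eq_of_smul_eq`) and ★
`valued_skew_ne_one_ram`. [cite: SerreLocalFields1979, Ch. IV §2 Prop. 5] -/
theorem valued_skew_apply_ne_one_ram (he : v.asIdeal.ramificationIdx' w.1.asIdeal ≠ 1) (h2w : Valued.v (2 : w.1.adicCompletion L) = 1)
    {y : LocalRing L v} (hy : conjLocal L (IsCMField.complexConj L) v y = -y) : Valued.v (y w) ≠ 1 := by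
  haveI : Algebra.IsQuadraticExtension ↥(maximalRealSubfield L) L := IsCMField.isQuadraticExtension L
  have hσy : galAdicCompletionMap (L := L) (IsCMField.complexConj L) hw (y w) = -(y w) := by
    rw [← conjLocal_apply_eq_of_smul_eq (IsCMField.complexConj L) (IsCMField.complexConj_ne_one L) v w hw y, hy, Pi.neg_apply]
  exact valued_skew_ne_one_ram L w hw he h2w hσy

include hw in
/-- **SHELL ZERO IN THE CHART: `|heisZ σ x y|_w = 1 ⟺ |x|_w = 1 ∧ |y|_w < 1`** at a tame ramified place (`y ∈ R⁻`): `|heisZ σ x y|_w = max(|x|_w², |y|_w)` (★ `valued_heisZ_apply_eq_max`)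
and `|y|_w ≠ 1` (§1). [cite: Rogawski1990, §1.10 p. 9] [cite: SerreLocalFields1979, Ch. IV §2 Prop. 5] -/
theorem valued_heisZ_apply_eq_one_iff_ram [Invertible (2 : LocalRing L v)] (he : v.asIdeal.ramificationIdx' w.1.asIdeal ≠ 1)
    (h2w : Valued.v (2 : w.1.adicCompletion L) = 1) (x : LocalRing L v) (y : ↥(HeisRing.skewPart (conjLocal L (IsCMField.complexConj L) v))) :
    Valued.v ((HeisRing.heisZ (conjLocal L (IsCMField.complexConj L) v) x y) w) = 1 ↔ Valued.v (x w) = 1 ∧ Valued.v ((y : LocalRing L v) w) < 1 := by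
  have hy1 := valued_skew_apply_ne_one_ram L v w hw he h2w y.2
  rw [valued_heisZ_apply_eq_max L v w hw h2w x y]
  constructor
  · intro h
    rcases le_total (Valued.v ((y : LocalRing L v) w)) (Valued.v (x w) * Valued.v (x w)) with hle | hle
    · rw [max_eq_left hle] at h
      have hx1 : Valued.v (x w) = 1 := by
        rcases lt_trichotomy (Valued.v (x w)) 1 with hlt | heq | hgt
        · have hlt2 : Valued.v (x w) * Valued.v (x w) < 1 :=
            lt_of_le_of_lt (by simpa only [mul_one] using mul_le_mul_right hlt.le (Valued.v (x w))) hlt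
          exact absurd h (ne_of_lt hlt2)
        · exact heq
        · exact absurd h (ne_of_gt (Left.one_lt_mul' hgt hgt))
      exact ⟨hx1, lt_of_le_of_ne (h ▸ hle) hy1⟩
    · rw [max_eq_right hle] at h
      exact absurd h hy1
  · rintro ⟨hx, hy⟩
    rw [hx, one_mul, max_eq_left hy.le]

/-! ## §2 The two shell-zero fibres -/

section Fibres

variable [MeasurableSpace (LocalRing L v)] [BorelSpace (LocalRing L v)]
  (μY : Measure ↥(HeisRing.skewPart (conjLocal L (IsCMField.complexConj L) v)))

include hw in
open scoped Classical in
/-- **FIBRE `|x|_w = 1` AT A TAME RAMIFIED PLACE: `∫_{y : |heisZ σ x y|_w = 1} E(heisZ σ x y) dμ⁻ = χ₁(−½) · μ⁻.real{|y|_w < 1}`.**  The fibre set is `{|y|_w < 1}` (§1); on it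
`heisZ σ x y = a + y = a·(1 + y∕a)` with `a = −½xσx` a `σ`-fixed unit (`|a|_w = 1`) and `1 + y∕a` a principal unit, so `E = χ₁(â)·χ₁(1 + y∕a) = χ₁(â)` (`hdepth`) and
`χ₁(â) = χ₁(−½)·χ₁(x̂·σx̂) = χ₁(−½)` (`hB`): the integrand is the constant `χ₁(−½)`.  (`−½` as the unit `−(unitOfInvertible 2)⁻¹`.) [cite: Keys1984, §7 Theorem (2) (d) p. 126]
[cite: Rogawski1990, §1.10 p. 9, §12.2 (2) p. 173] [cite: SerreLocalFields1979, Ch. IV §2 Prop. 5] -/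
theorem heisZFibre_eq_of_valued_eq_one_ram [Invertible (2 : LocalRing L v)] (he : v.asIdeal.ramificationIdx' w.1.asIdeal ≠ 1)
    (h2w : Valued.v (2 : w.1.adicCompletion L) = 1) (χ₁ : (LocalRing L v)ˣ →* ℂˣ)
    (hdepth : ∀ u : (LocalRing L v)ˣ, (∀ w' : PlacesOver L v, Valued.v (((u : LocalRing L v) w') - 1) < 1) → χ₁ u = 1)
    (hB : ∀ u : (LocalRing L v)ˣ, (∀ w' : PlacesOver L v, Valued.v ((u : LocalRing L v) w') = 1) →
      χ₁ (u * Units.map (conjLocal L (IsCMField.complexConj L) v : LocalRing L v →* LocalRing L v) u) = 1)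
    {x : LocalRing L v} (hx : Valued.v (x w) = 1) :
    ∫ y in {y : ↥(HeisRing.skewPart (conjLocal L (IsCMField.complexConj L) v)) |
        Valued.v ((HeisRing.heisZ (conjLocal L (IsCMField.complexConj L) v) x (y : LocalRing L v)) w) = 1},
        (fun r : LocalRing L v => if h : IsUnit r then ((χ₁ h.unit : ℂˣ) : ℂ) else 0)
          (HeisRing.heisZ (conjLocal L (IsCMField.complexConj L) v) x (y : LocalRing L v)) ∂μY =
      ((χ₁ (-(unitOfInvertible (2 : LocalRing L v))⁻¹) : ℂˣ) : ℂ) *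
        (μY.real {y : ↥(HeisRing.skewPart (conjLocal L (IsCMField.complexConj L) v)) | Valued.v ((y : LocalRing L v) w) < 1} : ℂ) := by
  -- the fibre set is `{|y|_w < 1}`
  have hset : {y : ↥(HeisRing.skewPart (conjLocal L (IsCMField.complexConj L) v)) |
        Valued.v ((HeisRing.heisZ (conjLocal L (IsCMField.complexConj L) v) x (y : LocalRing L v)) w) = 1} =
      {y : ↥(HeisRing.skewPart (conjLocal L (IsCMField.complexConj L) v)) | Valued.v ((y : LocalRing L v) w) < 1} := by
    ext y
    simp only [Set.mem_setOf_eq, valued_heisZ_apply_eq_one_iff_ram L v w hw he h2w x y, hx, true_and]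
  rw [hset]
  -- the chart point: `a = −½xσx`, fixed, `|a|_w = 1`
  obtain ⟨hfix, hval⟩ := conj_half_mul_conj_and_valued L v w hw h2w x
  rw [hx, mul_one] at hval
  set a : LocalRing L v := -(⅟ (2 : LocalRing L v) * (x * conjLocal L (IsCMField.complexConj L) v x)) with ha_def
  have ha0 : a w ≠ 0 := fun h0 => by rw [h0, map_zero] at hval; exact zero_ne_one hval
  have hua : IsUnit a := K2E3DepthZeroIwahoriCharacterCM.isUnit_of_apply_ne_zero L v w hw a ha0
  have hx0 : x w ≠ 0 := fun h0 => by rw [h0, map_zero] at hx; exact zero_ne_one hx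
  have hux : IsUnit x := K2E3DepthZeroIwahoriCharacterCM.isUnit_of_apply_ne_zero L v w hw x hx0
  -- `χ₁(â) = χ₁(−½)`: `â = (−(unitOfInvertible 2)⁻¹) · (x̂ · σx̂)` and `hB`
  have hchia : χ₁ hua.unit = χ₁ (-(unitOfInvertible (2 : LocalRing L v))⁻¹) := by
    have hunits : hua.unit = -(unitOfInvertible (2 : LocalRing L v))⁻¹ *
        (hux.unit * Units.map (conjLocal L (IsCMField.complexConj L) v : LocalRing L v →* LocalRing L v) hux.unit) := by
      ext
      rw [IsUnit.unit_spec, Units.val_mul, Units.val_neg, val_inv_unitOfInvertible, Units.val_mul, Units.coe_map, IsUnit.unit_spec, ha_def,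
        MonoidHom.coe_coe, neg_mul]
    rw [hunits, map_mul, hB hux.unit (forall_placesOver_of_apply L v w hw (P := fun w' => Valued.v ((hux.unit : LocalRing L v) w') = 1)
      (by rw [IsUnit.unit_spec]; exact hx)), mul_one]
  -- on the fibre set the integrand is the constant `χ₁(â)`
  have hconst : ∀ y ∈ {y : ↥(HeisRing.skewPart (conjLocal L (IsCMField.complexConj L) v)) | Valued.v ((y : LocalRing L v) w) < 1},
      (fun r : LocalRing L v => if h : IsUnit r then ((χ₁ h.unit : ℂˣ) : ℂ) else 0)
          (HeisRing.heisZ (conjLocal L (IsCMField.complexConj L) v) x (y : LocalRing L v)) =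
        ((χ₁ (-(unitOfInvertible (2 : LocalRing L v))⁻¹) : ℂˣ) : ℂ) := by
    intro y hy
    simp only [Set.mem_setOf_eq] at hy
    have hz : HeisRing.heisZ (conjLocal L (IsCMField.complexConj L) v) x (y : LocalRing L v) = a + (y : LocalRing L v) := by
      rw [heisZ_eq_neg_half_add]
    have hz1 : Valued.v ((a + (y : LocalRing L v)) w) = 1 := by
      rw [valued_add_apply_eq_max L v w hw h2w hfix y.2, hval, max_eq_left hy.le]
    have huz : IsUnit (a + (y : LocalRing L v)) :=
      K2E3DepthZeroIwahoriCharacterCM.isUnit_of_apply_ne_zero L v w hw _ (fun h0 => by rw [h0, map_zero] at hz1; exact zero_ne_one hz1)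
    simp only [hz, dif_pos huz]
    -- `(a + y)^ = â · u₁` with `u₁ = â⁻¹ (a + y)^` principal
    have hprin : χ₁ (hua.unit⁻¹ * huz.unit) = 1 := by
      refine hdepth _ (forall_placesOver_of_apply L v w hw (P := fun w' => Valued.v ((((hua.unit⁻¹ * huz.unit : (LocalRing L v)ˣ) : LocalRing L v) w') - 1) < 1) ?_)
      have hinv : ((hua.unit⁻¹ : (LocalRing L v)ˣ) : LocalRing L v) w * a w = 1 := by
        have h := congrFun hua.unit.inv_mul w
        rw [Pi.mul_apply, IsUnit.unit_spec, Pi.one_apply] at h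
        exact h
      have hainv : ((hua.unit⁻¹ : (LocalRing L v)ˣ) : LocalRing L v) w = (a w)⁻¹ := eq_inv_of_mul_eq_one_left hinv
      have hcalc : (((hua.unit⁻¹ * huz.unit : (LocalRing L v)ˣ) : LocalRing L v) w) - 1 = (a w)⁻¹ * (y : LocalRing L v) w := by
        rw [Units.val_mul, Pi.mul_apply, IsUnit.unit_spec, hainv, Pi.add_apply, mul_add, inv_mul_cancel₀ ha0, add_sub_cancel_left]
      show Valued.v ((((hua.unit⁻¹ * huz.unit : (LocalRing L v)ˣ) : LocalRing L v) w) - 1) < 1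
      rw [hcalc, map_mul, map_inv₀, hval, inv_one, one_mul]
      exact hy
    have hfac : huz.unit = hua.unit * (hua.unit⁻¹ * huz.unit) := by rw [mul_inv_cancel_left]
    rw [hfac, map_mul, hprin, mul_one, hchia]
  rw [setIntegral_congr_fun (measurableSet_skew_balls L v w).2.1 hconst, setIntegral_const,
    Complex.real_smul, mul_comm]

omit [BorelSpace (LocalRing L v)] in
include hw in
open scoped Classical in
/-- **FIBRE `|x|_w < 1` AT A TAME RAMIFIED PLACE: the `y`-fibre of `E ∘ z` over the shell is `0`** — the fibre set `{|heisZ σ x y|_w = 1}` is EMPTY (§1: it needs `|x|_w = 1`); at an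
inert place this fibre is `χ₁(δ₀)·μ⁻{|y|_w = 1} ≠ 0` (★ `heisZFibre_eq_of_valued_lt_one`). [cite: Keys1984, §7 Theorem (2) (d) p. 126] [cite: SerreLocalFields1979, Ch. IV §2 Prop. 5] -/
theorem heisZFibre_eq_zero_of_valued_lt_one_ram [Invertible (2 : LocalRing L v)] (he : v.asIdeal.ramificationIdx' w.1.asIdeal ≠ 1)
    (h2w : Valued.v (2 : w.1.adicCompletion L) = 1) (χ₁ : (LocalRing L v)ˣ →* ℂˣ) {x : LocalRing L v} (hx : Valued.v (x w) < 1) :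
    ∫ y in {y : ↥(HeisRing.skewPart (conjLocal L (IsCMField.complexConj L) v)) |
        Valued.v ((HeisRing.heisZ (conjLocal L (IsCMField.complexConj L) v) x (y : LocalRing L v)) w) = 1},
        (fun r : LocalRing L v => if h : IsUnit r then ((χ₁ h.unit : ℂˣ) : ℂ) else 0)
          (HeisRing.heisZ (conjLocal L (IsCMField.complexConj L) v) x (y : LocalRing L v)) ∂μY = 0 := by
  have hset : {y : ↥(HeisRing.skewPart (conjLocal L (IsCMField.complexConj L) v)) |
      Valued.v ((HeisRing.heisZ (conjLocal L (IsCMField.complexConj L) v) x (y : LocalRing L v)) w) = 1} = ∅ := by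
    ext y
    simp only [Set.mem_setOf_eq, Set.mem_empty_iff_false, iff_false, valued_heisZ_apply_eq_one_iff_ram L v w hw he h2w x y, not_and]
    intro h; exact absurd h (ne_of_lt hx)
  rw [hset, Measure.restrict_empty, integral_zero_measure]

end Fibres

end Summit.HodgeConjecture.HodgeConjecture.R90.S1

end
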